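import Mathlib
import HarnessLib
import Summits.QuantumFields.YangMills.Theses.ScalingWindowSplit

/-!
# `SelfNormalisedSkewness` (stmt-QuantumFields-18944) — negative lemma: the polynomial FLOOR is load-bearing

Crux W₂ = `ScalingWindowSplit.SelfNormalisedSkewness` carries four hypotheses on the datum
`(G, r, sch, u, p, M)`: weak coupling `β_k → ∞`, polynomial volumes, past support of `u`, and
eventually `a_k^p ≤ T⁰_k(u,θu)` (FLOOR) `∧ T⁰_k(u,θu) ≤ M · T⁰_k(τ₋₁u,θτ₋₁u)` (WINDOW).

`SelfNormalisedSkewnessWithoutFloor` is the crux with the floor conjunct deleted (everything else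
verbatim; the exponent `p` disappears with it), and `selfNormalisedSkewness_false_without_floor`
refutes it UNCONDITIONALLY with the c-number witness: the trivial gauge group `G = PUnit` in its
faithful `0`-dimensional unitary representation (`trivialLatticeRep`), the scheme `a_k = 1/(k+1)`,
`L_k = (k+1)²`, `β_k = k` (`linearCouplingScheme`) and `u = 0`.  There the action density is
identically `0`, so every bare lattice `n`-point function vanishes, `T⁰ ≡ 0`, the window reads
`0 ≤ M · 0`, the self-normalisation constant is `(√0)⁻¹ = 0` and the self-normalised third cumulant is
`0 < δ`: the conclusion fails while weak coupling, polynomial volumes (`N = 1`), past support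
(`tsupport 0 = ∅`) and the window hold.  Hence ANY proof of W₂ must use the floor `a_k^p ≤ T⁰_k(u,θu)`
(it is the only clause excluding c-number / deterministic curvature fields; with it the same witness
is a vacuous instance, `a_k^p > 0 = T⁰`).  Refuter crux-disproof artefact (cdisprove, 2026-08-17);
no `sorry`; axioms `propext`, `Classical.choice`, `Quot.sound`.
-/

noncomputable section

open scoped SchwartzMap BigOperators Topology
open MeasureTheory Filter Topology
open Literature.MathematicalPhysics.AQFT Literature.MathematicalPhysics.QuantumLattice
open Literature.MathematicalPhysics.QuantumFieldTheory

namespace Summit.QuantumFields.YangMills.Theorems.SelfNormalisedSkewness.Negative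

/-- **W₂ without its floor** (the MUTATED crux statement refuted below — a hypothesis-shaped `Prop`
of this negative lemma, deliberately carrying no citation tag: it is NOT a literature fact, it is
false, and it must stay in this file). Verbatim `ScalingWindowSplit.SelfNormalisedSkewness` with the
conjunct `(sch.a k) ^ p ≤ T u k` of the floor-and-window hypothesis deleted (and the then idle binder
`p` dropped). -/
def SelfNormalisedSkewnessWithoutFloor : Prop :=
  let E := EuclideanSpace ℝ (Fin 4); ∀ (G : Type) [Group G] [TopologicalSpace G] [IsTopologicalGroup G] [CompactSpace G] [MeasurableSpace G] [BorelSpace G] (r : LatticeRep G) (sch : SpeciesScheme (YMSpecies G)) (u : SchwartzMap E ℝ) (M : ℝ), let bare : SpeciesScheme (YMSpecies G) := { sch with c := fun _ _ => 1, m := fun _ _ => 0 }; let T : SchwartzMap E ℝ → ℕ → ℝ := fun w k => latticeSchwinger r.ρ bare (fun s => s.F) k (1 + 1) (fun _ => r.curvature) ![w, thetaTest 4 w] - latticeSchwinger r.ρ bare (fun s => s.F) k 1 (fun _ => r.curvature) ![w] * latticeSchwinger r.ρ bare (fun s => s.F) k 1 (fun _ => r.curvature) ![thetaTest 4 w]; let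 canon : SpeciesScheme (YMSpecies G) := { sch with c := fun _ k => (Real.sqrt (T u k))⁻¹, m := fun _ k => ∫ U, r.curvature.F (torusLift (sch.side k) U) ∂(wilsonMeasure r.ρ (sch.β k)) }; sch.HasWeakCouplingLimit → (∃ N : ℕ, 1 ≤ N ∧ ∀ᶠ k in Filter.atTop, (sch.a k)⁻¹ ≤ (sch.a k * (sch.L k : ℝ)) ^ N) → tsupport u ⊆ {y : E | y 0 < 0} → (∀ᶠ k in Filter.atTop, T u k ≤ M * T (timeShiftTest 4 (-1) u) k) → ∃ (f g h : SchwartzMap E ℝ) (δ : ℝ), Disjoint (tsupport f) (tsupport g) ∧ Disjoint (tsupport f) (tsupport h) ∧ Disjoint (tsupport g) (tsupport h) ∧ 0 < δ ∧ ∀ᶠ k in Filter.atTop, δ ≤ |latticeSchwinger r.ρ canon (fun s => s.F) k 3 (fun _ => r.curvature) ![f, g, h] - latticeSchwinger r.ρ canon (fun s => s.F) k 1 (fun _ => r.curvature) ![f] * latticeSchwinger r.ρ canon (fun s => s.F) k 2 (fun _ => r.curvature) ![g, h] - latticeSchwinger r.ρ canon (fun s => s.F) k 1 (fun _ => r.curvature)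 ![g] * latticeSchwinger r.ρ canon (fun s => s.F) k 2 (fun _ => r.curvature) ![f, h] - latticeSchwinger r.ρ canon (fun s => s.F) k 1 (fun _ => r.curvature) ![h] * latticeSchwinger r.ρ canon (fun s => s.F) k 2 (fun _ => r.curvature) ![f, g] + 2 * (latticeSchwinger r.ρ canon (fun s => s.F) k 1 (fun _ => r.curvature) ![f] * latticeSchwinger r.ρ canon (fun s => s.F) k 1 (fun _ => r.curvature) ![g] * latticeSchwinger r.ρ canon (fun s => s.F) k 1 (fun _ => r.curvature) ![h])|

/-- The faithful `0`-dimensional unitary representation of the trivial group (the c-number witness: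
its action density `∑_{i<j} Re tr ρ(U_p)` is identically `0`). [folklore] -/
def trivialLatticeRep : LatticeRep PUnit.{1} where
  N := 0
  ρ := 1
  continuous := continuous_const
  injective := Function.injective_of_subsingleton _
  mem_unitary := fun _ => Matrix.mem_unitaryGroup_iff.2 (Subsingleton.elim _ _)

/-- The weak-coupling scheme `a_k = 1/(k+1)`, `L_k = (k+1)²`, `β_k = k`, `c = m ≡ 0` (the tree's
degenerate scheme `SpeciesScheme.zero` with a linearly growing inverse coupling). [folklore] -/
def linearCouplingScheme (ι : Type) : SpeciesScheme ι :=
  { SpeciesScheme.zero ι with β := fun k => (k : ℝ) }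

/-- `β_k = k → ∞`: the scheme is at weak coupling. [folklore] -/
theorem linearCouplingScheme_hasWeakCouplingLimit (ι : Type) :
    (linearCouplingScheme ι).HasWeakCouplingLimit :=
  tendsto_natCast_atTop_atTop

/-- Polynomial volumes with exponent `N = 1`: `a_k⁻¹ = k + 1 = a_k L_k`. [folklore] -/
theorem linearCouplingScheme_polyVolume (ι : Type) :
    ∃ N : ℕ, 1 ≤ N ∧ ∀ᶠ k in Filter.atTop,
      ((linearCouplingScheme ι).a k)⁻¹ ≤ ((linearCouplingScheme ι).a k * ((linearCouplingScheme ι).L k : ℝ)) ^ N := by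
  refine ⟨1, le_rfl, Filter.Eventually.of_forall fun k => ?_⟩
  show (((k : ℝ) + 1)⁻¹)⁻¹ ≤ (((k : ℝ) + 1)⁻¹ * (((k + 1) ^ 2 : ℕ) : ℝ)) ^ 1
  have hk : (0 : ℝ) < (k : ℝ) + 1 := by positivity
  rw [inv_inv, pow_one]
  push_cast
  rw [sq, ← mul_assoc, inv_mul_cancel₀ hk.ne', one_mul]

/-- The action density of the `0`-dimensional representation vanishes identically. [folklore] -/
theorem trivialLatticeRep_curvature_F :
    (trivialLatticeRep.curvature).F = fun _ => (0 : ℝ) := by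
  funext U
  simp [LatticeRep.curvature, actionDensity, plaquetteObs, trivialLatticeRep]

/-- Every lattice `(n+1)`-point function of the curvature of the trivial witness vanishes for a scheme
whose multiplicative renormalisation of the curvature is `1` and counterterm `0` at step `k`
(the bare scheme), or whose multiplicative renormalisation is `0` (the collapsed self-normalised
scheme). [folklore] -/
theorem latticeSchwinger_trivial_eq_zero (S : SpeciesScheme (YMSpecies PUnit.{1})) (k n : ℕ)
    (f : Fin (n + 1) → 𝓢(EuclideanSpace ℝ (Fin 4), ℝ))
    (hS : (S.c trivialLatticeRep.curvature k = 1 ∧ S.m trivialLatticeRep.curvature k = 0) ∨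
      S.c trivialLatticeRep.curvature k = 0) :
    latticeSchwinger trivialLatticeRep.ρ S (fun s => s.F) k (n + 1)
      (fun _ => trivialLatticeRep.curvature) f = 0 := by
  unfold latticeSchwinger
  have h0 : ∀ (i : Fin (n + 1)) (U : GaugeConfig 4 (S.side k) PUnit.{1}),
      smearedLatticeField (trivialLatticeRep.curvature).F
        (Literature.Probability.LatticeModels.box 4 (S.L k)) (S.a k)
        (S.c trivialLatticeRep.curvature k) (S.m trivialLatticeRep.curvature k) (f i)
        (torusLift (S.side k) U) = 0 := by
    intro i U
    rcases hS with ⟨hc, hm⟩ | hc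
    · simp [smearedLatticeField, trivialLatticeRep_curvature_F, hm]
    · simp [smearedLatticeField, hc]
  have : (fun U : GaugeConfig 4 (S.side k) PUnit.{1} => ∏ i : Fin (n + 1),
      smearedLatticeField (trivialLatticeRep.curvature).F
        (Literature.Probability.LatticeModels.box 4 (S.L k)) (S.a k)
        (S.c trivialLatticeRep.curvature k) (S.m trivialLatticeRep.curvature k) (f i)
        (torusLift (S.side k) U)) = fun _ => 0 := by
    funext U
    exact Finset.prod_eq_zero (Finset.mem_univ 0) (h0 0 U)
  simp only [this, integral_zero]

/-- **The floor is load-bearing: W₂ without it is false** (unconditionally).  Witness: `G = PUnit`,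
`r = trivialLatticeRep`, `sch = linearCouplingScheme`, `u = 0`, any `M`; weak coupling, polynomial
volumes, past support and the window `0 ≤ M · 0` hold, every self-normalised cumulant is `0`. [folklore] -/
theorem selfNormalisedSkewness_false_without_floor : ¬ SelfNormalisedSkewnessWithoutFloor := by
  intro h
  have hT : ∀ (w : 𝓢(EuclideanSpace ℝ (Fin 4), ℝ)) (k : ℕ),
      latticeSchwinger trivialLatticeRep.ρ
          ({ linearCouplingScheme (YMSpecies PUnit.{1}) with c := fun _ _ => 1, m := fun _ _ => 0 } :
            SpeciesScheme (YMSpecies PUnit.{1})) (fun s => s.F) k (1 + 1)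
          (fun _ => trivialLatticeRep.curvature) ![w, thetaTest 4 w] -
        latticeSchwinger trivialLatticeRep.ρ
          ({ linearCouplingScheme (YMSpecies PUnit.{1}) with c := fun _ _ => 1, m := fun _ _ => 0 } :
            SpeciesScheme (YMSpecies PUnit.{1})) (fun s => s.F) k 1
          (fun _ => trivialLatticeRep.curvature) ![w] *
        latticeSchwinger trivialLatticeRep.ρ
          ({ linearCouplingScheme (YMSpecies PUnit.{1}) with c := fun _ _ => 1, m := fun _ _ => 0 } :
            SpeciesScheme (YMSpecies PUnit.{1})) (fun s => s.F) k 1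
          (fun _ => trivialLatticeRep.curvature) ![thetaTest 4 w] = 0 := by
    intro w k
    rw [latticeSchwinger_trivial_eq_zero _ k 1 _ (Or.inl ⟨rfl, rfl⟩),
      latticeSchwinger_trivial_eq_zero _ k 0 _ (Or.inl ⟨rfl, rfl⟩),
      latticeSchwinger_trivial_eq_zero _ k 0 _ (Or.inl ⟨rfl, rfl⟩)]
    ring
  have hsupp : tsupport ((0 : 𝓢(EuclideanSpace ℝ (Fin 4), ℝ)) : EuclideanSpace ℝ (Fin 4) → ℝ) ⊆
      {y : EuclideanSpace ℝ (Fin 4) | y 0 < 0} := by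
    intro y hy
    rw [show ((0 : 𝓢(EuclideanSpace ℝ (Fin 4), ℝ)) : EuclideanSpace ℝ (Fin 4) → ℝ) = 0 from rfl,
      tsupport_eq_empty_iff.2 rfl] at hy
    exact hy.elim
  have hwin : ∀ᶠ k in Filter.atTop,
      (fun w k => latticeSchwinger trivialLatticeRep.ρ
          ({ linearCouplingScheme (YMSpecies PUnit.{1}) with c := fun _ _ => 1, m := fun _ _ => 0 } :
            SpeciesScheme (YMSpecies PUnit.{1})) (fun s => s.F) k (1 + 1)
          (fun _ => trivialLatticeRep.curvature) ![w, thetaTest 4 w] -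
        latticeSchwinger trivialLatticeRep.ρ
          ({ linearCouplingScheme (YMSpecies PUnit.{1}) with c := fun _ _ => 1, m := fun _ _ => 0 } :
            SpeciesScheme (YMSpecies PUnit.{1})) (fun s => s.F) k 1
          (fun _ => trivialLatticeRep.curvature) ![w] *
        latticeSchwinger trivialLatticeRep.ρ
          ({ linearCouplingScheme (YMSpecies PUnit.{1}) with c := fun _ _ => 1, m := fun _ _ => 0 } :
            SpeciesScheme (YMSpecies PUnit.{1})) (fun s => s.F) k 1
          (fun _ => trivialLatticeRep.curvature) ![thetaTest 4 w]) 0 k ≤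
      (0 : ℝ) * (fun w k => latticeSchwinger trivialLatticeRep.ρ
          ({ linearCouplingScheme (YMSpecies PUnit.{1}) with c := fun _ _ => 1, m := fun _ _ => 0 } :
            SpeciesScheme (YMSpecies PUnit.{1})) (fun s => s.F) k (1 + 1)
          (fun _ => trivialLatticeRep.curvature) ![w, thetaTest 4 w] -
        latticeSchwinger trivialLatticeRep.ρ
          ({ linearCouplingScheme (YMSpecies PUnit.{1}) with c := fun _ _ => 1, m := fun _ _ => 0 } :
            SpeciesScheme (YMSpecies PUnit.{1})) (fun s => s.F) k 1
          (fun _ => trivialLatticeRep.curvature) ![w] *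
        latticeSchwinger trivialLatticeRep.ρ
          ({ linearCouplingScheme (YMSpecies PUnit.{1}) with c := fun _ _ => 1, m := fun _ _ => 0 } :
            SpeciesScheme (YMSpecies PUnit.{1})) (fun s => s.F) k 1
          (fun _ => trivialLatticeRep.curvature) ![thetaTest 4 w]) (timeShiftTest 4 (-1) 0) k :=
    Filter.Eventually.of_forall fun k => by simp only [hT, mul_zero, le_refl]
  obtain ⟨f, g, h₃, δ, -, -, -, hδ, hev⟩ :=
    h PUnit trivialLatticeRep (linearCouplingScheme _) 0 0
      (linearCouplingScheme_hasWeakCouplingLimit _) (linearCouplingScheme_polyVolume _) hsupp hwin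
  -- the self-normalised scheme has `c'_k = (√0)⁻¹ = 0`, so every canonical `n`-point function vanishes
  have hc : ∀ k : ℕ, (Real.sqrt ((fun w k => latticeSchwinger trivialLatticeRep.ρ
          ({ linearCouplingScheme (YMSpecies PUnit.{1}) with c := fun _ _ => 1, m := fun _ _ => 0 } :
            SpeciesScheme (YMSpecies PUnit.{1})) (fun s => s.F) k (1 + 1)
          (fun _ => trivialLatticeRep.curvature) ![w, thetaTest 4 w] -
        latticeSchwinger trivialLatticeRep.ρ
          ({ linearCouplingScheme (YMSpecies PUnit.{1}) with c := fun _ _ => 1, m := fun _ _ => 0 } :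
            SpeciesScheme (YMSpecies PUnit.{1})) (fun s => s.F) k 1
          (fun _ => trivialLatticeRep.curvature) ![w] *
        latticeSchwinger trivialLatticeRep.ρ
          ({ linearCouplingScheme (YMSpecies PUnit.{1}) with c := fun _ _ => 1, m := fun _ _ => 0 } :
            SpeciesScheme (YMSpecies PUnit.{1})) (fun s => s.F) k 1
          (fun _ => trivialLatticeRep.curvature) ![thetaTest 4 w]) 0 k))⁻¹ = 0 := by
    intro k
    simp only [hT, Real.sqrt_zero, inv_zero]
  obtain ⟨k, hk⟩ := hev.exists
  revert hk
  rw [latticeSchwinger_trivial_eq_zero _ k 2 _ (Or.inr (hc k)),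
    latticeSchwinger_trivial_eq_zero _ k 1 _ (Or.inr (hc k)),
    latticeSchwinger_trivial_eq_zero _ k 1 _ (Or.inr (hc k)),
    latticeSchwinger_trivial_eq_zero _ k 1 _ (Or.inr (hc k)),
    latticeSchwinger_trivial_eq_zero _ k 0 _ (Or.inr (hc k)),
    latticeSchwinger_trivial_eq_zero _ k 0 _ (Or.inr (hc k)),
    latticeSchwinger_trivial_eq_zero _ k 0 _ (Or.inr (hc k))]
  norm_num
  exact hδ

end Summit.QuantumFields.YangMills.Theorems.SelfNormalisedSkewness.Negative

end
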